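import Summits.KontsevichZagierPeriods.KontsevichZagierPeriods.Theorems.LinRedNormalFormHoffmanSpanInKZEdsDSLeafOfOddDet
import Summits.KontsevichZagierPeriods.KontsevichZagierPeriods.Theorems.FurushoPentagonKernelModuloPeriodConjectureLeafOfCheckBlocksCX
import HarnessLib

/-!
# Crux `LinRedNormalForm.HoffmanSpanInKZ` (stmt-KontsevichZagierPeriods-15044), line `eds-ds`:
# generic cell-block masters (`checkBlockC`, `checkBlockCX`)

Line `eds-ds` (lead c3). Generic twins of the block masters of the `LinEDS` soundness chain (route
FurushoPentagon, crux stmt-15058, `…LeafOfCheckBlocks*`): from a chain of kernel-certified depth blocks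
(`LinEDS.checkBlockC` / `checkBlockCX`) to the Hoffman expansion of every admissible index of weight `k` — here at
every group-like series `φ` over a commutative `ℚ`-algebra with `c_y(φ) = 0` ON WHICH THE VALID ROWS OF
WEIGHT `k` VANISH, instead of at every group-like pentagon solution (the pentagon enters the original chain
only through E5; the generic cores are `stub_leafRows_of_oddDet(Sum)`, file `…EdsDSLeafOfOddDet`). The
block bookkeeping (block lower-triangular determinant with odd diagonal blocks, columns covered by the
chain, valid names) is reused BY NAME from the FurushoPentagon files; only the final master statements are
re-proved, verbatim, against the generic cores. Fed with the landed block certificates of weights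
`14 … 17` and E5′ (`stub_rowZ_of_gds`) they give the double-shuffle leaf `LeafDS` of this line.

References: K. Ihara, M. Kaneko, D. Zagier, Compos. Math. 142 (2006) §2, Conjecture 1
[IharaKanekoZagier2006]; M. Kaneko, M. Noro, K. Tsurumaki, IMA Vol. Math. Appl. 148 (2008).
-/

namespace Summit.KontsevichZagierPeriods.LinRedNormalForm.HoffmanSpanInKZ

open Literature.NumberTheory.Transcendental
open Literature.NumberTheory.Transcendental.LinEDS
open Summit.KontsevichZagierPeriods.FurushoPentagon.KernelModuloPeriodConjecture

/-- **The leaf from a chain of cell block certificates** (generic twin, line `eds-ds`, of FurushoPentagon's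
`stub_leaf_of_checkBlocksC`, lead c7; generic twin for line `eds-ds` of crux stmt-KontsevichZagierPeriods-15044):
a chain `bl` of blocks `(cells, later)` with `chainOK k bl`, each certified by
`LinEDS.checkBlockC` at some width `W'` with enough fuel (`2^(k-1) ≤ W'(f+1)`, so the fold is
complete) ⇒ the Hoffman expansion of every admissible index of weight `k` at every group-like series with `c_y = 0` on which the valid rows vanish. [cite: IharaKanekoZagier2006, Conjecture 1] -/
theorem stub_leafRows_of_checkBlocksC :
    ∀ (k : ℕ) (bl : List (List (ℕ × List ℕ) × List (ℕ × List ℕ))), 2 ≤ k →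
      LinEDS.chainOK k bl = true →
      (∀ p ∈ bl, ∃ (W' f : ℕ) (L : List ℕ) (groups : List (List (List ℕ × List ℕ))),
        2 ^ (k - 1) ≤ W' * (f + 1) ∧ LinEDS.checkBlockC k W' f p.1 p.2 L groups = true) →
      ∀ s : List ℕ, MZV.IsAdmissible s → MZV.weight s = k →
        ∃ b : List ℕ →₀ ℚ, (∀ t ∈ b.support, MZV.IsHoffman t ∧ MZV.weight t = MZV.weight s) ∧ ∀ (R : Type) [CommRing R] [Algebra ℚ R] (φ : NCSeries Bool R), NCSeries.IsGroupLike φ → φ [true] = 0 → (∀ nm : List ℕ × List ℕ, LinEDS.validName k nm = true → LinEDS.evalZ φ (LinEDS.rowZ nm) = 0) → φ (MZV.binaryWord s) = b.sum (fun t q => q • φ (MZV.binaryWord t)) := by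
  classical
  intro k bl hk hchain hblocks s hs hw
  choose Wq fq Lq nm hfuel hnm using hblocks
  -- the chain condition
  have hch := hchain
  simp only [LinEDS.chainOK, Bool.and_eq_true] at hch
  obtain ⟨hnest, hcover'⟩ := hch
  have hcover := Nat.eq_of_beq_eq_true hcover'
  set ms := bl.map fun p => (LinEDS.cellsMask k p.1 &&& LinEDS.colMask k, LinEDS.cellsMask k p.2)
    with hms
  set B := bl.length with hB
  have hmsl : ms.length = B := by simp [hms, hB]
  have hmsget : ∀ β : Fin B, ms.get (Fin.cast hmsl.symm β) =
      (LinEDS.cellsMask k (bl.get β).1 &&& LinEDS.colMask k, LinEDS.cellsMask k (bl.get β).2) := by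
    intro β; simp [hms]
  have hmemβ : ∀ β : Fin B, bl.get β ∈ bl := fun β => List.get_mem _ _
  let W' : Fin B → ℕ := fun β => Wq (bl.get β) (hmemβ β)
  let fu : Fin B → ℕ := fun β => fq (bl.get β) (hmemβ β)
  let L : Fin B → List ℕ := fun β => Lq (bl.get β) (hmemβ β)
  let groups : Fin B → List (List (List ℕ × List ℕ)) := fun β => nm (bl.get β) (hmemβ β)
  have hchk : ∀ β, LinEDS.checkBlockC k (W' β) (fu β) (bl.get β).1 (bl.get β).2 (L β) (groups β) = true :=
    fun β => hnm _ _
  have hfu : ∀ β, 2 ^ (k - 1) ≤ W' β * (fu β + 1) := fun β => hfuel _ _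
  let nb : Fin B → ℕ := fun β => (L β).length
  have hlen : ∀ β, (L β).length = (groups β).length := fun β => ((blocksC_checkBlockC (hchk β)).1).symm
  have hmask : ∀ β, LinEDS.maskOf (L β) = LinEDS.cellsMask k (bl.get β).1 &&& LinEDS.colMask k :=
    fun β => (blocksC_checkBlockC (hchk β)).2.1
  -- positions, groups and columns
  let ν : (Σ β : Fin B, Fin (nb β)) → List (List ℕ × List ℕ) :=
    fun i => (groups i.1).get (Fin.cast (hlen i.1) i.2)
  let col : (Σ β : Fin B, Fin (nb β)) → ℕ := fun j => (L j.1).get j.2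
  have hvalid : ∀ i, ∀ μ ∈ ν i, LinEDS.validName k μ = true :=
    fun i => (blocksC_checkBlockC (hchk i.1)).2.2.2.2.1 _ (List.get_mem _ _)
  have hcolL : ∀ j, col j ∈ L j.1 := fun j => List.get_mem _ _
  have hcolmem : ∀ j, col j ∈ LinEDS.cols k := fun j => blocksC_mem_cols hk (hmask j.1) (hcolL j)
  obtain ⟨-, -, -, hcm⟩ := stub_cols_spec k hk
  -- every column lies in a block (the covering half of `chainOK`)
  have hcolsurj : ∀ c ∈ LinEDS.cols k, ∃ j, col j = c := by
    intro c hc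
    have hbit : (LinEDS.orAll (ms.map Prod.fst)).testBit c = true := by rw [hcover]; exact (hcm c).mpr hc
    obtain ⟨m, hm, hmc⟩ := (LinEDS.testBit_orAll c _).mp hbit
    obtain ⟨q, hq, rfl⟩ := List.mem_map.mp hm
    obtain ⟨p, hp, rfl⟩ := List.mem_map.mp hq
    obtain ⟨β', hβ'⟩ := List.mem_iff_get.mp hp
    let β : Fin B := Fin.cast rfl β'
    have hpβ : p = bl.get β := hβ'.symm
    subst hpβ
    have hcL : c ∈ L β := by
      rw [← blocksE13_testBit_maskOf, hmask β]; exact hmc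
    obtain ⟨y, hy⟩ := List.mem_iff_get.mp hcL
    exact ⟨⟨β, y⟩, hy⟩
  -- nesting: a later block's columns lie in the `later` cells of an earlier block
  have hsub : ∀ β β' : Fin B, β < β' →
      (LinEDS.cellsMask k (bl.get β').1 &&& LinEDS.colMask k) &&& LinEDS.cellsMask k (bl.get β).2 =
        LinEDS.cellsMask k (bl.get β').1 &&& LinEDS.colMask k := by
    intro β β' hlt'
    have := LinEDS.chainNested_get ms hnest (Fin.cast hmsl.symm β) (Fin.cast hmsl.symm β') hlt'
    rwa [hmsget, hmsget] at this
  -- odd determinant, by blocks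
  have hdet : Odd (Matrix.of fun i j => LinEDS.entryG k (ν i) (col j)).det := by
    refine stub_blockDet_odd B nb _ (fun i j hij => ?_) (fun β => ?_)
    · rw [Matrix.of_apply, ← Int.not_odd_iff_even,
        ← blocksG_rowBitsG_parity (hvalid i) (hcolmem j)]
      -- bit (col j) of the `later` mask of block i.1 is set
      have hlater : (LinEDS.cellsMask k (bl.get i.1).2).testBit (col j) = true := by
        have hb : (LinEDS.cellsMask k (bl.get j.1).1 &&& LinEDS.colMask k).testBit (col j) = true := by
          rw [← hmask j.1]; exact (blocksE13_testBit_maskOf _ _).mpr (hcolL j)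
        rw [← hsub i.1 j.1 hij, Nat.testBit_land, Bool.and_eq_true] at hb
        exact hb.2
      have hzero := (blocksC_checkBlockC (hchk i.1)).2.2.2.2.2.1 _
        (List.get_mem _ (Fin.cast (hlen i.1) i.2))
      have hbit := congrArg (·.testBit (col j)) hzero
      simp only [Nat.testBit_land, Nat.zero_testBit, hlater, Bool.and_true] at hbit
      show ¬ (LinEDS.rowBitsG k (ν i)).testBit (col j) = true
      rw [hbit]; exact Bool.false_ne_true
    · exact blocksC_diag_odd hk (hchk β) (hfu β) (hlen β)
  exact stub_leafRows_of_oddDetSum k _ ν col hk hvalid hcolmem hcolsurj hdet s hs hw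

/-- **The leaf from a chain of cell block certificates, plain or with precomputed filler rows**
(generic twin, line `eds-ds`, of FurushoPentagon's `stub_leaf_of_checkBlocksCX`, lead c7; generic twin for line `eds-ds` of crux stmt-KontsevichZagierPeriods-15044): a chain `bl` of blocks `(cells, later)` with `chainOK k bl`, each block certified
EITHER by the plain `checkBlockC` OR by `checkBlockCX` together with the provenance `checkExtra` of
its extras (at some width with enough fuel) ⇒ the Hoffman expansion of every admissible index of weight `k` at every group-like series with `c_y = 0` on which the valid rows vanish.
[cite: IharaKanekoZagier2006, Conjecture 1] -/
theorem stub_leafRows_of_checkBlocksCX :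
    ∀ (k : ℕ) (bl : List (List (ℕ × List ℕ) × List (ℕ × List ℕ))), 2 ≤ k →
      LinEDS.chainOK k bl = true →
      (∀ p ∈ bl,
        (∃ (W' f : ℕ) (L : List ℕ) (groups : List (List (List ℕ × List ℕ))),
          2 ^ (k - 1) ≤ W' * (f + 1) ∧ LinEDS.checkBlockC k W' f p.1 p.2 L groups = true) ∨
        (∃ (W' f : ℕ) (L : List ℕ) (groups : List (List (List ℕ × List ℕ))) (extra : List ℕ)
            (pgroups : List (List (List ℕ × List ℕ))),
          2 ^ (k - 1) ≤ W' * (f + 1) ∧ LinEDS.checkBlockCX k W' f p.1 p.2 L groups extra = true ∧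
            LinEDS.checkExtra k p.1 p.2 L extra pgroups = true)) →
      ∀ s : List ℕ, MZV.IsAdmissible s → MZV.weight s = k →
        ∃ b : List ℕ →₀ ℚ, (∀ t ∈ b.support, MZV.IsHoffman t ∧ MZV.weight t = MZV.weight s) ∧ ∀ (R : Type) [CommRing R] [Algebra ℚ R] (φ : NCSeries Bool R), NCSeries.IsGroupLike φ → φ [true] = 0 → (∀ nm : List ℕ × List ℕ, LinEDS.validName k nm = true → LinEDS.evalZ φ (LinEDS.rowZ nm) = 0) → φ (MZV.binaryWord s) = b.sum (fun t q => q • φ (MZV.binaryWord t)) := by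
  intro k bl hk hchain hblocks s hs hw
  refine stub_leafRows_of_checkBlocksC k bl hk hchain (fun p hp => ?_) s hs hw
  rcases hblocks p hp with h | ⟨W', f, L, groups, extra, pgroups, hfuel, hX, hE⟩
  · exact h
  · exact ⟨W', f, L, _, hfuel, checkBlockC_of_checkBlockCX hX hE⟩

end Summit.KontsevichZagierPeriods.LinRedNormalForm.HoffmanSpanInKZ
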